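import Summits.QuantumFields.YangMills.Theorems.FluctuationComparisonRegPrIntLS2BetaTubeRegularSmall
import HarnessLib

/-!
# (RG-K) ORBIT TRANSPORT of the (T)-chain's letters, I — the residual group, the tube clause, the orbit functional, the good fibre; TUBE♭ ∕ GAP♭ are EQUIVARIANT under `(V, U₀, U) ↦ (u↓•V, u•U₀, u•U)`

Helper for crux `stmt-QuantumFields-20520` (`Theses.UnitScaleTilt.FluctuationComparisonRegPrIntL`), the (T)-chain of LINE
`semiclassical_s2beta` (cell `ym3-torus`, width seat «width 16» px16 g18).  [Balaban1985Variational] treats the datum `V` of the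
constrained variational problem up to gauge (p.278 «the space 𝔘_k is gauge invariant», Sect. G p.305 «V = V′V₀», axial gauge for `V′`).
The 19200 lineage transported PRINT's letters along gauge orbits (✓`Prop7OrbitTransport`: `IsCritR2`, `SameOrbit`, both clauses of
Prop. 7); THIS FILE (and its sequel `…TubeLettersOrbitTransportOutright`) does the same for the (T)-chain's own letters, whose texts
(✓`…S2BetaFlatGapOfIsolated`, ✓(T3) `…TubeGrowthOfHessianPosDock`, ✓px8 `tubeGrowth_of_pos_of_isolated`) speak of

  the DESCENT-PRESERVING group `R := {w | ∀ X, D_{J,K}(w•X) = D_{J,K} X}`, the sup-tube clause `∃ w ∈ R, ∀ ℓ, dist1 (U ℓ·((w•U₀) ℓ)⁻¹) ≤ δ`,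
  the orbit functional `𝒟(U;U₀) := ⨅_{w ∈ R} Σ_ℓ dist1 (U ℓ·((w•U₀) ℓ)⁻¹)²`, the good fibre `fibre V ∩ histGood` and its closure,
  `wilsonAction4` and `minActionRegPr … ε₀ V`.

Under a fine gauge transformation `u` (coarse image `u↓ = descTransf u`): `R` is normalised (`w ↦ u·w·u⁻¹`, §1), the tube clause and `𝒟`
are INVARIANT under `(U, U₀) ↦ (u•U, u•U₀)` (conjugation invariance of `dist1`, §1), the good fibre over `V` is carried onto the good
fibre over `u↓•V` together with its closure (`u•·` is a homeomorphism; ✓`gaugeAct_mem_fibre_iff`, ✓`gaugeAct_mem_histGood_iff`, §2), the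
action and `minActionRegPr` are invariant (✓`wilsonAction4_gaugeAct`, ✓`minActionRegPr_gaugeAct`).  Hence (§3)

* ★★ `tubeGrowthAt_gaugeAct_iff` — TUBE♭ at `(u↓•V, u•U₀)` (radius `δ`, constant `c`) ⟺ TUBE♭ at `(V, U₀)`;
* ★★ `gapFlatAt_gaugeAct_iff` — GAP♭ likewise (POS∘ ∕ ISOL∘ and the pure-gauge-datum inhabitants: the sequel).

HONEST: finite-group ∕ topology bookkeeping over landed letters; nothing of Bałaban's analysis; this file proves NO stub of the line —
TUBE-REG∘ (K-uniform `μ`, universal `δ`), GAP♯∘, EXW∘, S2β and crux 20520 stay OPEN; rung R3 (YM₃ on T³) is NOT d = 4, NOT infinite volume,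
NOT a mass gap, NOT Clay; the Yang–Mills mass gap is NOT proved.
-/

set_option autoImplicit false

noncomputable section

open Set Filter Topology Function
open scoped Matrix.Norms.L2Operator
open Literature.MathematicalPhysics.QuantumFieldTheory.Balaban1983to89
open Literature.MathematicalPhysics.QuantumFieldTheory.Balaban1983to89.T3ContinuumYM3Torus
open Literature.MathematicalPhysics.QuantumFieldTheory.Balaban1983to89.T3UnitLawDensityEML (ℰp)
open Literature.MathematicalPhysics.QuantumFieldTheory.Balaban1983to89.T3UnitScaleTilt
open Literature.MathematicalPhysics.QuantumFieldTheory.Balaban1983to89.T3TiltDescent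
open Literature.MathematicalPhysics.QuantumFieldTheory.Balaban1983to89.T3ConstrainedMinimiser (fibre)
open Literature.MathematicalPhysics.QuantumFieldTheory.Balaban1983to89.T3PrintedRegularMinimiser
open Literature.MathematicalPhysics.QuantumFieldTheory.Balaban1983to89.T3PrintedRegularOrbits
open scoped Literature.MathematicalPhysics.QuantumFieldTheory.Balaban1983to89.T3OrbitAverage
open Literature.MathematicalPhysics.QuantumFieldTheory.Balaban1983to89.T3OrbitAverage (continuous_gaugeAct)
open Summit.QuantumFields.YangMills.Theorems.FluctuationComparisonRegPrIntLS2BetaResidualGauge (gaugeAct_mem_histGood_iff wilsonAction4_gaugeAct)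
open Summit.QuantumFields.YangMills.Theorems.FluctuationComparisonRegPrIntLS2BetaTubeRegularSmall (gaugeAct_gaugeAct_inv)

namespace Summit.QuantumFields.YangMills.Theorems.FluctuationComparisonRegPrIntLS2BetaTubeLettersOrbitTransport

variable (F : T3Family) {J K : ℕ} (hJK : J ≤ K)

/-! ## §1 The descent-preserving group is normalised; the tube clause and the orbit functional are invariant -/

/-- `(u·w·u⁻¹) • (u • X) = u • (w • X)`. [cite: Balaban1985Averaging, (8) p.19] -/
theorem conj_gaugeAct_gaugeAct (u w : Site (F.P K) 0 → Matrix.specialUnitaryGroup (Fin 2) ℂ)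
    (X : GaugeField (F.P K) 0 (Matrix.specialUnitaryGroup (Fin 2) ℂ)) :
    GaugeField.gaugeAct (fun x => u x * w x * (u x)⁻¹) (GaugeField.gaugeAct u X) = GaugeField.gaugeAct u (GaugeField.gaugeAct w X) := by
  funext b
  show u b.src * w b.src * (u b.src)⁻¹ * (u b.src * X b * (u b.tgt)⁻¹) * (u b.tgt * w b.tgt * (u b.tgt)⁻¹)⁻¹ =
    u b.src * (w b.src * X b * (w b.tgt)⁻¹) * (u b.tgt)⁻¹
  group

/-- `u⁻¹ • (u • X) = X`. [cite: Balaban1985Averaging, (8) p.19] -/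
theorem inv_gaugeAct_gaugeAct (u : Site (F.P K) 0 → Matrix.specialUnitaryGroup (Fin 2) ℂ)
    (X : GaugeField (F.P K) 0 (Matrix.specialUnitaryGroup (Fin 2) ℂ)) :
    GaugeField.gaugeAct (fun x => (u x)⁻¹) (GaugeField.gaugeAct u X) = X := by
  funext b
  show (u b.src)⁻¹ * (u b.src * X b * (u b.tgt)⁻¹) * ((u b.tgt)⁻¹)⁻¹ = X b
  group

/-- **THE DESCENT-PRESERVING GROUP IS NORMALISED BY EVERY FINE GAUGE TRANSFORMATION**: if `w` preserves every `D_{J,K}`-fibre then so does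
`u·w·u⁻¹` (covariance ✓`descendTo_gaugeAct`: `D(u•Y) = u↓•D Y`, and `(u⁻¹)↓ = (u↓)⁻¹`). [cite: Balaban1985Averaging, (11)-(13) p.19; Balaban1985Variational, (4) p.278] -/
theorem conj_descentPreserving (u : Site (F.P K) 0 → Matrix.specialUnitaryGroup (Fin 2) ℂ)
    {w : Site (F.P K) 0 → Matrix.specialUnitaryGroup (Fin 2) ℂ}
    (hw : ∀ X : GaugeField (F.P K) 0 (Matrix.specialUnitaryGroup (Fin 2) ℂ),
      descendTo F ℰp J K hJK (GaugeField.gaugeAct w X) = descendTo F ℰp J K hJK X) :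
    ∀ X : GaugeField (F.P K) 0 (Matrix.specialUnitaryGroup (Fin 2) ℂ),
      descendTo F ℰp J K hJK (GaugeField.gaugeAct (fun x => u x * w x * (u x)⁻¹) X) = descendTo F ℰp J K hJK X := by
  intro X
  have hX : X = GaugeField.gaugeAct u (GaugeField.gaugeAct (fun x => (u x)⁻¹) X) := (gaugeAct_gaugeAct_inv F u X).symm
  conv_lhs => rw [hX, conj_gaugeAct_gaugeAct]
  rw [descendTo_gaugeAct, hw, ← descendTo_gaugeAct, gaugeAct_gaugeAct_inv]

/-- **THE BONDWISE ORBIT DISTANCE IS A CONJUGATION INVARIANT**: `dist1 ((u•U) ℓ·((u•W) ℓ)⁻¹) = dist1 (U ℓ·(W ℓ)⁻¹)`. [cite: Balaban1985Averaging, (8) p.19] -/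
theorem dist1_gaugeAct_mul_inv (u : Site (F.P K) 0 → Matrix.specialUnitaryGroup (Fin 2) ℂ)
    (U W : GaugeField (F.P K) 0 (Matrix.specialUnitaryGroup (Fin 2) ℂ)) (ℓ : PBond (F.P K) 0) :
    dist1 ((GaugeField.gaugeAct u U) ℓ * ((GaugeField.gaugeAct u W) ℓ)⁻¹) = dist1 (U ℓ * (W ℓ)⁻¹) := by
  have h1 : (GaugeField.gaugeAct u U) ℓ * ((GaugeField.gaugeAct u W) ℓ)⁻¹ = u ℓ.src * (U ℓ * (W ℓ)⁻¹) * (u ℓ.src)⁻¹ := by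
    show u ℓ.src * U ℓ * (u ℓ.tgt)⁻¹ * (u ℓ.src * W ℓ * (u ℓ.tgt)⁻¹)⁻¹ = u ℓ.src * (U ℓ * (W ℓ)⁻¹) * (u ℓ.src)⁻¹
    group
  rw [h1, GaugeGroup.dist1_conj]

/-- **THE SUP-TUBE CLAUSE IS INVARIANT** under `(U, U₀) ↦ (u•U, u•U₀)`. [cite: Balaban1985UV3, (12)-(13) p.259] -/
theorem tube_gaugeAct_iff (u : Site (F.P K) 0 → Matrix.specialUnitaryGroup (Fin 2) ℂ)
    (U U₀ : GaugeField (F.P K) 0 (Matrix.specialUnitaryGroup (Fin 2) ℂ)) (δ : ℝ) :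
    (∃ w : Site (F.P K) 0 → Matrix.specialUnitaryGroup (Fin 2) ℂ,
        (∀ U'' : GaugeField (F.P K) 0 (Matrix.specialUnitaryGroup (Fin 2) ℂ),
            descendTo F ℰp J K hJK (GaugeField.gaugeAct w U'') = descendTo F ℰp J K hJK U'') ∧
          ∀ ℓ : PBond (F.P K) 0, dist1 ((GaugeField.gaugeAct u U) ℓ * ((GaugeField.gaugeAct w (GaugeField.gaugeAct u U₀)) ℓ)⁻¹) ≤ δ) ↔
    (∃ w : Site (F.P K) 0 → Matrix.specialUnitaryGroup (Fin 2) ℂ,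
        (∀ U'' : GaugeField (F.P K) 0 (Matrix.specialUnitaryGroup (Fin 2) ℂ),
            descendTo F ℰp J K hJK (GaugeField.gaugeAct w U'') = descendTo F ℰp J K hJK U'') ∧
          ∀ ℓ : PBond (F.P K) 0, dist1 (U ℓ * ((GaugeField.gaugeAct w U₀) ℓ)⁻¹) ≤ δ) := by
  constructor
  · rintro ⟨w, hw, hδ⟩
    -- pull back by `u`: `w' := u⁻¹·w·u`
    refine ⟨fun x => (u x)⁻¹ * w x * ((u x)⁻¹)⁻¹, conj_descentPreserving F hJK (fun x => (u x)⁻¹) hw, fun ℓ => ?_⟩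
    have key : GaugeField.gaugeAct w (GaugeField.gaugeAct u U₀) =
        GaugeField.gaugeAct u (GaugeField.gaugeAct (fun x => (u x)⁻¹ * w x * ((u x)⁻¹)⁻¹) U₀) := by
      funext b
      show w b.src * (u b.src * U₀ b * (u b.tgt)⁻¹) * (w b.tgt)⁻¹ =
        u b.src * ((u b.src)⁻¹ * w b.src * ((u b.src)⁻¹)⁻¹ * U₀ b * ((u b.tgt)⁻¹ * w b.tgt * ((u b.tgt)⁻¹)⁻¹)⁻¹) * (u b.tgt)⁻¹
      group
    have h2 := hδ ℓ
    rwa [key, dist1_gaugeAct_mul_inv] at h2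
  · rintro ⟨w, hw, hδ⟩
    refine ⟨fun x => u x * w x * (u x)⁻¹, conj_descentPreserving F hJK u hw, fun ℓ => ?_⟩
    rw [conj_gaugeAct_gaugeAct, dist1_gaugeAct_mul_inv]
    exact hδ ℓ

/-- **THE ORBIT FUNCTIONAL IS INVARIANT**: `𝒟(u•U; u•U₀) = 𝒟(U; U₀)` — conjugation by `u` is a bijection of the descent-preserving group and
preserves every summand. [cite: Balaban1985UV3, (12)-(13) p.259; Balaban1985Variational, (4) p.278] -/
theorem iInf_orbitDistSq_gaugeAct (u : Site (F.P K) 0 → Matrix.specialUnitaryGroup (Fin 2) ℂ)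
    (U U₀ : GaugeField (F.P K) 0 (Matrix.specialUnitaryGroup (Fin 2) ℂ)) :
    (⨅ w : {w : Site (F.P K) 0 → Matrix.specialUnitaryGroup (Fin 2) ℂ |
        ∀ X : GaugeField (F.P K) 0 (Matrix.specialUnitaryGroup (Fin 2) ℂ),
          descendTo F ℰp J K hJK (GaugeField.gaugeAct w X) = descendTo F ℰp J K hJK X},
      ∑ ℓ : PBond (F.P K) 0,
        dist1 ((GaugeField.gaugeAct u U) ℓ *
          ((GaugeField.gaugeAct (w : Site (F.P K) 0 → Matrix.specialUnitaryGroup (Fin 2) ℂ) (GaugeField.gaugeAct u U₀)) ℓ)⁻¹) ^ 2) =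
    (⨅ w : {w : Site (F.P K) 0 → Matrix.specialUnitaryGroup (Fin 2) ℂ |
        ∀ X : GaugeField (F.P K) 0 (Matrix.specialUnitaryGroup (Fin 2) ℂ),
          descendTo F ℰp J K hJK (GaugeField.gaugeAct w X) = descendTo F ℰp J K hJK X},
      ∑ ℓ : PBond (F.P K) 0,
        dist1 (U ℓ * ((GaugeField.gaugeAct (w : Site (F.P K) 0 → Matrix.specialUnitaryGroup (Fin 2) ℂ) U₀) ℓ)⁻¹) ^ 2) := by
  -- conjugation `w ↦ u·w·u⁻¹` as an equivalence of the descent-preserving subtype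
  let e : {w : Site (F.P K) 0 → Matrix.specialUnitaryGroup (Fin 2) ℂ |
        ∀ X : GaugeField (F.P K) 0 (Matrix.specialUnitaryGroup (Fin 2) ℂ),
          descendTo F ℰp J K hJK (GaugeField.gaugeAct w X) = descendTo F ℰp J K hJK X} ≃
      {w : Site (F.P K) 0 → Matrix.specialUnitaryGroup (Fin 2) ℂ |
        ∀ X : GaugeField (F.P K) 0 (Matrix.specialUnitaryGroup (Fin 2) ℂ),
          descendTo F ℰp J K hJK (GaugeField.gaugeAct w X) = descendTo F ℰp J K hJK X} :=
    { toFun := fun w => ⟨fun x => u x * (w : Site (F.P K) 0 → Matrix.specialUnitaryGroup (Fin 2) ℂ) x * (u x)⁻¹,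
        conj_descentPreserving F hJK u w.2⟩
      invFun := fun w => ⟨fun x => (u x)⁻¹ * (w : Site (F.P K) 0 → Matrix.specialUnitaryGroup (Fin 2) ℂ) x * ((u x)⁻¹)⁻¹,
        conj_descentPreserving F hJK (fun x => (u x)⁻¹) w.2⟩
      left_inv := fun w => by ext x; simp only; group
      right_inv := fun w => by ext x; simp only; group }
  symm
  refine Equiv.iInf_congr e fun w => ?_
  refine Finset.sum_congr rfl fun ℓ _ => ?_
  show dist1 ((GaugeField.gaugeAct u U) ℓ *
      ((GaugeField.gaugeAct (fun x => u x * (w : Site (F.P K) 0 → Matrix.specialUnitaryGroup (Fin 2) ℂ) x * (u x)⁻¹)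
        (GaugeField.gaugeAct u U₀)) ℓ)⁻¹) ^ 2 = _
  rw [conj_gaugeAct_gaugeAct, dist1_gaugeAct_mul_inv]

/-! ## §2 The good fibre and its closure are carried along -/

/-- **THE GOOD FIBRE IS CARRIED ONTO THE GOOD FIBRE**: `u•U ∈ fibre (u↓•V) ∩ histGood ⟺ U ∈ fibre V ∩ histGood`.
[cite: Balaban1985Variational, (3)-(4) p.278; Balaban1985UV3, (7) p.257] -/
theorem gaugeAct_mem_goodFibre_iff (u : Site (F.P K) 0 → Matrix.specialUnitaryGroup (Fin 2) ℂ) {γ b₀ p₀ : ℝ}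
    (V : GaugeField (F.P J) 0 (Matrix.specialUnitaryGroup (Fin 2) ℂ)) (U : GaugeField (F.P K) 0 (Matrix.specialUnitaryGroup (Fin 2) ℂ)) :
    GaugeField.gaugeAct u U ∈ fibre F ℰp J K hJK (GaugeField.gaugeAct (descTransf F J K hJK u) V) ∩ histGood F ℰp (θBal F.L γ b₀ p₀) K J ↔
      U ∈ fibre F ℰp J K hJK V ∩ histGood F ℰp (θBal F.L γ b₀ p₀) K J := by
  rw [mem_inter_iff, mem_inter_iff, gaugeAct_mem_fibre_iff, gaugeAct_mem_histGood_iff]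

/-- The good fibre over `u↓•V` IS the `u`-image of the good fibre over `V`. [cite: Balaban1985Variational, (3)-(4) p.278] -/
theorem goodFibre_gaugeAct_eq_image (u : Site (F.P K) 0 → Matrix.specialUnitaryGroup (Fin 2) ℂ) {γ b₀ p₀ : ℝ}
    (V : GaugeField (F.P J) 0 (Matrix.specialUnitaryGroup (Fin 2) ℂ)) :
    fibre F ℰp J K hJK (GaugeField.gaugeAct (descTransf F J K hJK u) V) ∩ histGood F ℰp (θBal F.L γ b₀ p₀) K J =
      GaugeField.gaugeAct u '' (fibre F ℰp J K hJK V ∩ histGood F ℰp (θBal F.L γ b₀ p₀) K J) := by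
  ext U
  constructor
  · intro hU
    refine ⟨GaugeField.gaugeAct (fun x => (u x)⁻¹) U, ?_, gaugeAct_gaugeAct_inv F u U⟩
    rw [← gaugeAct_mem_goodFibre_iff F hJK u, gaugeAct_gaugeAct_inv]
    exact hU
  · rintro ⟨W, hW, rfl⟩
    exact (gaugeAct_mem_goodFibre_iff F hJK u V W).2 hW

/-- **… AND SO IS ITS CLOSURE** (`U ↦ u•U` is a homeomorphism of `SU(2)^{bonds}`). [cite: Balaban1985Averaging, (8) p.19] -/
theorem closure_goodFibre_gaugeAct_eq_image (u : Site (F.P K) 0 → Matrix.specialUnitaryGroup (Fin 2) ℂ) {γ b₀ p₀ : ℝ}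
    (V : GaugeField (F.P J) 0 (Matrix.specialUnitaryGroup (Fin 2) ℂ)) :
    closure (fibre F ℰp J K hJK (GaugeField.gaugeAct (descTransf F J K hJK u) V) ∩ histGood F ℰp (θBal F.L γ b₀ p₀) K J) =
      GaugeField.gaugeAct u '' closure (fibre F ℰp J K hJK V ∩ histGood F ℰp (θBal F.L γ b₀ p₀) K J) := by
  let φ : GaugeField (F.P K) 0 (Matrix.specialUnitaryGroup (Fin 2) ℂ) ≃ₜ GaugeField (F.P K) 0 (Matrix.specialUnitaryGroup (Fin 2) ℂ) :=
    { toFun := GaugeField.gaugeAct u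
      invFun := GaugeField.gaugeAct (fun x => (u x)⁻¹)
      left_inv := fun X => inv_gaugeAct_gaugeAct F u X
      right_inv := fun X => gaugeAct_gaugeAct_inv F u X
      continuous_toFun := continuous_gaugeAct u
      continuous_invFun := continuous_gaugeAct _ }
  rw [goodFibre_gaugeAct_eq_image]
  exact (φ.image_closure _).symm

/-- Membership form: `U ∈ closure (good fibre over u↓•V) ⟺ u⁻¹•U ∈ closure (good fibre over V)`. [cite: Balaban1985Variational, (3)-(4) p.278] -/
theorem mem_closure_goodFibre_gaugeAct_iff (u : Site (F.P K) 0 → Matrix.specialUnitaryGroup (Fin 2) ℂ) {γ b₀ p₀ : ℝ}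
    (V : GaugeField (F.P J) 0 (Matrix.specialUnitaryGroup (Fin 2) ℂ)) (U : GaugeField (F.P K) 0 (Matrix.specialUnitaryGroup (Fin 2) ℂ)) :
    GaugeField.gaugeAct u U ∈ closure (fibre F ℰp J K hJK (GaugeField.gaugeAct (descTransf F J K hJK u) V) ∩ histGood F ℰp (θBal F.L γ b₀ p₀) K J) ↔
      U ∈ closure (fibre F ℰp J K hJK V ∩ histGood F ℰp (θBal F.L γ b₀ p₀) K J) := by
  rw [closure_goodFibre_gaugeAct_eq_image]
  constructor
  · rintro ⟨W, hW, hWU⟩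
    have : W = U := by
      have h := congrArg (GaugeField.gaugeAct (fun x => (u x)⁻¹)) hWU
      rwa [inv_gaugeAct_gaugeAct, inv_gaugeAct_gaugeAct] at h
    exact this ▸ hW
  · exact fun hU => ⟨U, hU, rfl⟩

/-! ## §3 The letters TUBE♭, GAP♭, POS∘, ISOL∘ are equivariant -/

/-- ★★ **TUBE♭ IS EQUIVARIANT**: tube growth at `(u↓•V, u•U₀)` with radius `δ`, weight `η² = (L⁻¹)^{2(K−J)}` and constant `c` ⟺ tube growth at
`(V, U₀)` with the same `δ, c` (texts = ✓brick 5 `exists_tubeGrowth_flat_of_isolated`'s last clause with `(1,1) ↦ (V,U₀)`).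
[cite: Balaban1985Variational, (142) p.299, p.278; Balaban1985UV3, (18)-(22) p.260] -/
theorem tubeGrowthAt_gaugeAct_iff (u : Site (F.P K) 0 → Matrix.specialUnitaryGroup (Fin 2) ℂ) {γ b₀ p₀ ε₀ : ℝ} (hε₀ : 0 ≤ ε₀)
    (V : GaugeField (F.P J) 0 (Matrix.specialUnitaryGroup (Fin 2) ℂ)) (U₀ : GaugeField (F.P K) 0 (Matrix.specialUnitaryGroup (Fin 2) ℂ))
    (δ c : ℝ) :
    (∀ U ∈ fibre F ℰp J K hJK (GaugeField.gaugeAct (descTransf F J K hJK u) V), U ∈ histGood F ℰp (θBal F.L γ b₀ p₀) K J →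
      (∃ w : Site (F.P K) 0 → Matrix.specialUnitaryGroup (Fin 2) ℂ,
        (∀ U'' : GaugeField (F.P K) 0 (Matrix.specialUnitaryGroup (Fin 2) ℂ),
          descendTo F ℰp J K hJK (GaugeField.gaugeAct w U'') = descendTo F ℰp J K hJK U'') ∧
        ∀ ℓ : PBond (F.P K) 0, dist1 (U ℓ * ((GaugeField.gaugeAct w (GaugeField.gaugeAct u U₀)) ℓ)⁻¹) ≤ δ) →
      c * ((F.L : ℝ)⁻¹) ^ (2 * (K - J)) *
        (⨅ w : {w : Site (F.P K) 0 → Matrix.specialUnitaryGroup (Fin 2) ℂ |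
            ∀ U : GaugeField (F.P K) 0 (Matrix.specialUnitaryGroup (Fin 2) ℂ),
              descendTo F ℰp J K hJK (GaugeField.gaugeAct w U) = descendTo F ℰp J K hJK U},
          ∑ ℓ : PBond (F.P K) 0,
            dist1 (U ℓ * ((GaugeField.gaugeAct (w : Site (F.P K) 0 → Matrix.specialUnitaryGroup (Fin 2) ℂ) (GaugeField.gaugeAct u U₀)) ℓ)⁻¹) ^ 2)
        ≤ wilsonAction4 U - minActionRegPr F J K hJK ε₀ (GaugeField.gaugeAct (descTransf F J K hJK u) V)) ↔
    (∀ U ∈ fibre F ℰp J K hJK V, U ∈ histGood F ℰp (θBal F.L γ b₀ p₀) K J →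
      (∃ w : Site (F.P K) 0 → Matrix.specialUnitaryGroup (Fin 2) ℂ,
        (∀ U'' : GaugeField (F.P K) 0 (Matrix.specialUnitaryGroup (Fin 2) ℂ),
          descendTo F ℰp J K hJK (GaugeField.gaugeAct w U'') = descendTo F ℰp J K hJK U'') ∧
        ∀ ℓ : PBond (F.P K) 0, dist1 (U ℓ * ((GaugeField.gaugeAct w U₀) ℓ)⁻¹) ≤ δ) →
      c * ((F.L : ℝ)⁻¹) ^ (2 * (K - J)) *
        (⨅ w : {w : Site (F.P K) 0 → Matrix.specialUnitaryGroup (Fin 2) ℂ |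
            ∀ U : GaugeField (F.P K) 0 (Matrix.specialUnitaryGroup (Fin 2) ℂ),
              descendTo F ℰp J K hJK (GaugeField.gaugeAct w U) = descendTo F ℰp J K hJK U},
          ∑ ℓ : PBond (F.P K) 0,
            dist1 (U ℓ * ((GaugeField.gaugeAct (w : Site (F.P K) 0 → Matrix.specialUnitaryGroup (Fin 2) ℂ) U₀) ℓ)⁻¹) ^ 2)
        ≤ wilsonAction4 U - minActionRegPr F J K hJK ε₀ V) := by
  rw [minActionRegPr_gaugeAct F hJK hε₀]
  constructor
  · intro h U hUf hUh htube
    have hU' := (gaugeAct_mem_goodFibre_iff F hJK u (γ := γ) (b₀ := b₀) (p₀ := p₀) V U).2 ⟨hUf, hUh⟩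
    have h1 := h (GaugeField.gaugeAct u U) hU'.1 hU'.2 ((tube_gaugeAct_iff F hJK u U U₀ δ).2 htube)
    rwa [iInf_orbitDistSq_gaugeAct, wilsonAction4_gaugeAct] at h1
  · intro h U hUf hUh htube
    obtain ⟨W, rfl⟩ : ∃ W, U = GaugeField.gaugeAct u W := ⟨_, (gaugeAct_gaugeAct_inv F u U).symm⟩
    have hW := (gaugeAct_mem_goodFibre_iff F hJK u (γ := γ) (b₀ := b₀) (p₀ := p₀) V W).1 ⟨hUf, hUh⟩
    have h1 := h W hW.1 hW.2 ((tube_gaugeAct_iff F hJK u W U₀ δ).1 htube)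
    rwa [iInf_orbitDistSq_gaugeAct, wilsonAction4_gaugeAct]

/-- ★★ **GAP♭ IS EQUIVARIANT**: the global growth over the good fibre at `(u↓•V, u•U₀)` with constant `c` ⟺ at `(V, U₀)` (texts = ✓brick 5
`exists_gapFlat_flat_of_isolated`'s last clause with `(1,1) ↦ (V,U₀)`). [cite: Balaban1985Variational, (142) p.299, p.278; Balaban1984PropagatorsII, (1.33)] -/
theorem gapFlatAt_gaugeAct_iff (u : Site (F.P K) 0 → Matrix.specialUnitaryGroup (Fin 2) ℂ) {γ b₀ p₀ ε₀ : ℝ} (hε₀ : 0 ≤ ε₀)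
    (V : GaugeField (F.P J) 0 (Matrix.specialUnitaryGroup (Fin 2) ℂ)) (U₀ : GaugeField (F.P K) 0 (Matrix.specialUnitaryGroup (Fin 2) ℂ))
    (c : ℝ) :
    (∀ U ∈ fibre F ℰp J K hJK (GaugeField.gaugeAct (descTransf F J K hJK u) V), U ∈ histGood F ℰp (θBal F.L γ b₀ p₀) K J →
      c * ((F.L : ℝ)⁻¹) ^ (2 * (K - J)) *
        (⨅ w : {w : Site (F.P K) 0 → Matrix.specialUnitaryGroup (Fin 2) ℂ |
            ∀ U : GaugeField (F.P K) 0 (Matrix.specialUnitaryGroup (Fin 2) ℂ),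
              descendTo F ℰp J K hJK (GaugeField.gaugeAct w U) = descendTo F ℰp J K hJK U},
          ∑ ℓ : PBond (F.P K) 0,
            dist1 (U ℓ * ((GaugeField.gaugeAct (w : Site (F.P K) 0 → Matrix.specialUnitaryGroup (Fin 2) ℂ) (GaugeField.gaugeAct u U₀)) ℓ)⁻¹) ^ 2)
        ≤ wilsonAction4 U - minActionRegPr F J K hJK ε₀ (GaugeField.gaugeAct (descTransf F J K hJK u) V)) ↔
    (∀ U ∈ fibre F ℰp J K hJK V, U ∈ histGood F ℰp (θBal F.L γ b₀ p₀) K J →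
      c * ((F.L : ℝ)⁻¹) ^ (2 * (K - J)) *
        (⨅ w : {w : Site (F.P K) 0 → Matrix.specialUnitaryGroup (Fin 2) ℂ |
            ∀ U : GaugeField (F.P K) 0 (Matrix.specialUnitaryGroup (Fin 2) ℂ),
              descendTo F ℰp J K hJK (GaugeField.gaugeAct w U) = descendTo F ℰp J K hJK U},
          ∑ ℓ : PBond (F.P K) 0,
            dist1 (U ℓ * ((GaugeField.gaugeAct (w : Site (F.P K) 0 → Matrix.specialUnitaryGroup (Fin 2) ℂ) U₀) ℓ)⁻¹) ^ 2)
        ≤ wilsonAction4 U - minActionRegPr F J K hJK ε₀ V) := by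
  rw [minActionRegPr_gaugeAct F hJK hε₀]
  constructor
  · intro h U hUf hUh
    have hU' := (gaugeAct_mem_goodFibre_iff F hJK u (γ := γ) (b₀ := b₀) (p₀ := p₀) V U).2 ⟨hUf, hUh⟩
    have h1 := h (GaugeField.gaugeAct u U) hU'.1 hU'.2
    rwa [iInf_orbitDistSq_gaugeAct, wilsonAction4_gaugeAct] at h1
  · intro h U hUf hUh
    obtain ⟨W, rfl⟩ : ∃ W, U = GaugeField.gaugeAct u W := ⟨_, (gaugeAct_gaugeAct_inv F u U).symm⟩
    have hW := (gaugeAct_mem_goodFibre_iff F hJK u (γ := γ) (b₀ := b₀) (p₀ := p₀) V W).1 ⟨hUf, hUh⟩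
    have h1 := h W hW.1 hW.2
    rwa [iInf_orbitDistSq_gaugeAct, wilsonAction4_gaugeAct]

end Summit.QuantumFields.YangMills.Theorems.FluctuationComparisonRegPrIntLS2BetaTubeLettersOrbitTransport

end
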